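import Mathlib
import Summits.NavierStokesRegularity.NavierStokesRegularity.Theses.EulerZoomLiouville
import Summits.NavierStokesRegularity.NavierStokesRegularity.Theorems.EulerZoomLiouvillePowerGaugeEulerLiouvilleLargeRho
import Summits.NavierStokesRegularity.NavierStokesRegularity.Theorems.EulerZoomLiouvillePowerGaugeEulerLiouvillePastIrrotational
import Summits.NavierStokesRegularity.NavierStokesRegularity.Theorems.EulerZoomLiouvillePowerGaugeEulerLiouvilleSwirlfreeLedgerDecay
import Summits.NavierStokesRegularity.NavierStokesRegularity.Theorems.EulerZoomLiouvillePowerGaugeEulerLiouvilleSwirlfreeLedgerEndgame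
import Summits.NavierStokesRegularity.NavierStokesRegularity.Theorems.EulerZoomLiouvillePowerGaugeEulerLiouvilleSwirlfreeLedgerConfinement
import Literature.Analysis.FluidPDE.AxisymmetricEuler
import Literature.Analysis.FluidPDE.AxisymNoSwirlVorticity
import Literature.Analysis.FluidPDE.ClassicalSolution
import Literature.Analysis.FluidPDE.VectorCalculus
import HarnessLib.Audit

/-!
# Line `swirlfree-ledger` (ideator ns-idea-11 g0, lens «complete» = program-completion) for the crux
# `EulerZoomLiouville.PowerGaugeEulerLiouville` (stmt-NavierStokesRegularity-19832)

PROGRAMME COMPLETED.  Seregin, *A note on potential Type II blowups of some special classes of solutions to the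
Navier–Stokes equations*, arXiv:2606.29468 (2026), §4, Prop. 4.1 (p. 13): for the Euler zoom limit of an axisymmetric
Type II blow-up the material quantity `ω_θ / r` gives a conserved `g(t) = ∫ (|ω_θ|/r)^{l₁/2}`, and the author writes that it
"could be used for further analysis of ancient solutions to the Euler equations" — but his version needs the inherited
second-gradient bound `N^{s₁,l₁}` ((4.2) there), which the crux class (energy `A`, gradient `E`, pressure `D` gauges only)
does NOT carry.  This line completes the programme INSIDE the crux class on the stratum where the material ledger closes
without (4.2): CLASSICAL axisymmetric swirl-free members whose velocity decays into the past at a sub-parabolic rate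
`‖u(τ)‖_∞ ≤ M (−τ)^{−κ}`, `κ > 1/2` (the class rate `κ = (1+ρ)/(2+ρ) ∈ (1/2, 3/5]` included).

THE LEVER (new on this crux; neither `birth` v28 nor `rungC_window` has a lever on non-self-similar, genuinely time-dependent
members with UNRESTRICTED vortex stretching):  the axis ledger `f = |curl u| / r` (`= |ω_θ| / r` for swirl-free axisymmetric
fields, `Literature…AxisymNoSwirlVorticity.curl_eq_hadamardQuotFst_smul_rotGen`) is MATERIALLY CONSERVED by classical
swirl-free axisymmetric Euler flows (vortex stretching is absorbed exactly by the weight `1/r`; Majda–Bertozzi §2.3.3,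
Ukhovskii–Yudovich 1968), the flow is volume preserving, and
  (S1) the `E`-gauge + Hölder against the axis weight `∫_{B(a)} r^{-s} = (4π/(2−s)) a^{3−s}` (`s = 2q/(2−q) < 2 ⇔ q < 1`) give the
       WINDOWED LEDGER DECAY `∫_{−a²}^{0} ∫_{B(a)} f^q ≤ C a^{5−3q−qρ/2}`, whose per-unit-time average `a^{3−3q−qρ/2} → 0`
       exactly when `q > 6/(6+ρ)` — a non-empty exponent range `(6/(6+ρ), 1)` for every `ρ > 0`;
  (S2) sub-parabolic drift (`κ > 1/2`: backward displacement over `(−a², t₀)` is `O(a^{2−2κ}) = o(a)`) CONFINES the fluid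
       parcels of `B(R₀)` at time `t₀` inside `B(a)` at every time `t₁ ∈ (−a², t₀)`, so the conserved ledger is MONOTONE:
       `∫_{B(R₀)} f(t₀)^q ≤ ∫_{B(a)} f(t₁)^q`;
  (S3) averaging (S2) over `t₁ ∈ (−a², −a²/2)` against (S1) forces `∫_{B(R₀)} f(t₀)^q = 0` for all `t₀ < 0`, `R₀ > 0`, i.e.
       `curl u ≡ 0` on the whole past, and the lead's LANDED filler `PastIrrotational.ae_eq_zero_of_gauge_of_pastIrrotational`
       (irrotational incompressible `C²` past + `A`-gauge ⇒ trivial) concludes;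
  (S4) the remainder (members outside the stratum) is the honest open residue — it contains `birth`'s three open stubs minus
       this stratum and is NOT claimed.
The composition `PowerGaugeEulerLiouville_of` is kernel-checked (no sorry of its own); sorries live only in `stub_*`.
STATUS 2026-08-28 (ns-sfl-p1 g2): S1, S2, S3 FILLED BY NAME (p607678, p609033+p609539, p607773; all `--supports stmt-19832 --as helper`);
the only remaining `sorry` is the declared residue S4 `stub_driftlessRest` (= crux ∖ stratum, NOT claimed).
No summit is proved by a line.
-/

open MeasureTheory Set Filter Topology Metric
open scoped ENNReal NNReal
open Literature.Analysis Literature.Analysis.FluidPDE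

set_option linter.dupNamespace false

namespace Summit.NavierStokesRegularity.NavierStokesRegularity.Cruxes.PowerGaugeEulerLiouville.SwirlfreeLedger

/-- Local abbreviation: ℝ³. -/
abbrev E3 : Type := EuclideanSpace ℝ (Fin 3)

/-- Membership in Seregin's power-gauged ancient Euler class — verbatim the three hypotheses of the crux (same as `Birth.InClass`). -/
@[reducible] def InClass (ρ : ℝ) (u : ℝ → E3 → E3) (p : ℝ → E3 → ℝ) (H : ℝ → E3 → E3 →L[ℝ] E3)
    (c : ℝ≥0) : Prop :=
  IsSuitableWeakSolutionOn (slab (EuclideanSpace ℝ (Fin 3)) (Set.Iio 0) isOpen_Iio) 0 0 u p ∧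
    HasWeakSpatialGradientOn (slab (EuclideanSpace ℝ (Fin 3)) (Set.Iio 0) isOpen_Iio) u H ∧
    (∀ a : ℝ, 0 < a →
      ENNReal.ofReal (a ^ (2 * ρ)) * cknA a (0 : ℝ × E3) u + ENNReal.ofReal (a ^ ρ) * cknE a (0 : ℝ × E3) H +
        ENNReal.ofReal (a ^ (2 * ρ)) * cknD a (0 : ℝ × E3) p ≤ (c : ℝ≥0∞))

/-- The conclusion of the crux: `u` vanishes a.e. on the past slab. -/
@[reducible] def VanishesAE (u : ℝ → E3 → E3) : Prop :=
  Function.uncurry u =ᵐ[volume.restrict (Set.Iio (0 : ℝ) ×ˢ (Set.univ : Set E3))] 0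

/-- THE AXIS LEDGER `f(v)(x) = |curl v (x)| / r(x)` (`r` = distance to the symmetry axis; junk value `0` on the axis, a
null set).  For a swirl-free axisymmetric `C²` field `curl v = (ω_θ/r) • (−x₁, x₀, 0)`, so `f = |ω_θ| / r` off the axis
(`curl_eq_hadamardQuotFst_smul_rotGen`); for classical swirl-free axisymmetric Euler flows `ω_θ / r` is transported:
`D_t (ω_θ / r) = 0` (Majda–Bertozzi, Vorticity and Incompressible Flow, §2.3.3; Ukhovskii–Yudovich 1968). -/
noncomputable def axisLedger (v : E3 → E3) (x : E3) : ℝ :=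
  ‖curl v x‖ / cylRadius x

/-- THE STRATUM: classical axisymmetric swirl-free members with SUB-PARABOLIC DRIFT — `(u,p)` is a classical Euler solution on
`(−∞,0) × ℝ³`, every slice is axisymmetric without swirl, and `‖u(τ,x)‖ ≤ M (−τ)^{−κ}` for some `κ > 1/2` (the class rate
`κ = (1+ρ)/(2+ρ)` of a Type II zoom limit with matched velocity rate is such a `κ`). -/
def IsSwirlFreeDrifting (u : ℝ → E3 → E3) (p : ℝ → E3 → ℝ) : Prop :=
  IsClassicalEulerSolutionOn (Set.Iio 0) 0 u p ∧
    (∀ τ : ℝ, τ < 0 → IsAxisymmetric (u τ) ∧ HasNoSwirl (u τ)) ∧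
    ∃ M κ : ℝ, 1 / 2 < κ ∧ ∀ τ : ℝ, τ < 0 → ∀ x : E3, ‖u τ x‖ ≤ M * (-τ) ^ (-κ)

/-- WINDOWED LEDGER DECAY with exponent `q`: `∫_{−a²}^{0} ∫_{B(a)} f^q ≤ C · a^{5 − 3q − qρ/2}` for all `a ≥ 1`. -/
def LedgerDecay (ρ q : ℝ) (u : ℝ → E3 → E3) : Prop :=
  ∃ C : ℝ≥0, ∀ a : ℝ, 1 ≤ a →
    ∫⁻ τ in Set.Ioo (-a ^ 2) 0, ∫⁻ x in ball (0 : E3) a, ENNReal.ofReal (axisLedger (u τ) x ^ q) ≤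
      (C : ℝ≥0∞) * ENNReal.ofReal (a ^ (5 - 3 * q - q * ρ / 2))

/-- MONOTONE LEDGER with exponent `q`: the `q`-ledger of a late ball `B(R₀)` at time `t₀ < 0` is dominated by the `q`-ledger of
`B(a)` at EVERY earlier time `t₁ ∈ (−a², t₀)`, once `a` is large (material conservation + volume preservation + confinement). -/
def LedgerMonotone (q : ℝ) (u : ℝ → E3 → E3) : Prop :=
  ∀ t₀ : ℝ, t₀ < 0 → ∀ R₀ : ℝ, 0 < R₀ → ∃ A₀ : ℝ, 0 < A₀ ∧ ∀ a : ℝ, A₀ ≤ a → ∀ t₁ ∈ Set.Ioo (-a ^ 2) t₀,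
    ∫⁻ x in ball (0 : E3) R₀, ENNReal.ofReal (axisLedger (u t₀) x ^ q) ≤
      ∫⁻ x in ball (0 : E3) a, ENNReal.ofReal (axisLedger (u t₁) x ^ q)

/-! ## Registered stub signatures -/

/-- Signature of `stub_axisLedgerDecay` (S1, size M): in the window, a CLASSICAL member has windowed ledger decay for every
`q ∈ (6/(6+ρ), 1)` — `E`-gauge (`∫_{Q(a)} |∇u|² ≤ c a^{1−ρ}`, the weak gradient `H` of a classical member is `∇u` a.e.), `|curl u| ≤ 2 |∇u|`,
and Hölder against the locally integrable axis weight `r^{−2q/(2−q)}` (`2q/(2−q) < 2 ⇔ q < 1`). -/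
def Sig.stub_axisLedgerDecay : Prop :=
  ∀ ρ : ℝ, 0 < ρ → ρ ≤ 1 / 2 → ∀ (u : ℝ → E3 → E3) (p : ℝ → E3 → ℝ) (H : ℝ → E3 → E3 →L[ℝ] E3) (c : ℝ≥0),
    InClass ρ u p H c → IsClassicalEulerSolutionOn (Set.Iio 0) 0 u p →
      ∀ q : ℝ, 6 / (6 + ρ) < q → q < 1 → LedgerDecay ρ q u

/-- Signature of `stub_materialConfinement` (S2, size L, the HARDEST provable stub): on the stratum the ledger is monotone for every
`q > 0` — `ω_θ/r` is constant along particle paths (classical swirl-free axisymmetric Euler), the flow map is volume preserving, and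
sub-parabolic drift (`κ > 1/2`) keeps the parcels of `B(R₀)` (time `t₀`) inside `B(a)` for all `t₁ ∈ (−a², t₀)` once
`R₀ + M ∫_{−a²}^{t₀} (−s)^{−κ} ds < a`. -/
def Sig.stub_materialConfinement : Prop :=
  ∀ (u : ℝ → E3 → E3) (p : ℝ → E3 → ℝ), IsSwirlFreeDrifting u p → ∀ q : ℝ, 0 < q → LedgerMonotone q u

/-- Signature of `stub_ledgerEndgame` (S3, size M): in the window, a classical member with decaying AND monotone `q`-ledger for one
`q ∈ (6/(6+ρ), 1)` is trivial — average the monotone bound over `t₁ ∈ (−a², −a²/2)`, compare with the decay (`a^{3−3q−qρ/2} → 0`), get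
`∫_{B(R₀)} f(t₀)^q = 0`, hence `curl (u t₀) = 0` a.e. and then everywhere (continuity), for every `t₀ < 0`; conclude with the landed
`PastIrrotational.ae_eq_zero_of_gauge_of_pastIrrotational` (`T₁ = 0`). -/
def Sig.stub_ledgerEndgame : Prop :=
  ∀ ρ : ℝ, 0 < ρ → ρ ≤ 1 / 2 → ∀ (u : ℝ → E3 → E3) (p : ℝ → E3 → ℝ) (H : ℝ → E3 → E3 →L[ℝ] E3) (c : ℝ≥0),
    InClass ρ u p H c → IsClassicalEulerSolutionOn (Set.Iio 0) 0 u p →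
      (∃ q : ℝ, 6 / (6 + ρ) < q ∧ q < 1 ∧ LedgerDecay ρ q u ∧ LedgerMonotone q u) → VanishesAE u

/-- Signature of `stub_driftlessRest` (S4, OPEN, crux-sized — NOT claimed by this line): in the window, members OUTSIDE the stratum
(not classical, or not axisymmetric swirl-free, or without sub-parabolic velocity decay) are trivial.  This is where `birth` v28's three
open stubs live, minus the stratum above. -/
def Sig.stub_driftlessRest : Prop :=
  ∀ ρ : ℝ, 0 < ρ → ρ ≤ 1 / 2 → ∀ (u : ℝ → E3 → E3) (p : ℝ → E3 → ℝ) (H : ℝ → E3 → E3 →L[ℝ] E3) (c : ℝ≥0),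
    InClass ρ u p H c → ¬ IsSwirlFreeDrifting u p → VanishesAE u

/-! ## Stubs -/

/-- STUB S1 [FILLED BY NAME — p607678 `Theorems/…SwirlfreeLedgerDecay.lean`, `SwirlfreeLedger.axisLedgerDecay_of_classical`
(ns-sfl-p1 g2): `H = ∇u` a.e. (`hasWeakSpatialGradientOn_of_contDiffOn` + `HasWeakSpatialGradientOn.ae_eq`), `E`-gauge, Hölder
`2/q`–`2/(2−q)` on `(−a²,0)×B(a)` against `r^{−q}`, axis weight `Literature/…/AxisDistancePowerIntegral` (p607099); glue = `exact`]. -/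
theorem stub_axisLedgerDecay : Sig.stub_axisLedgerDecay :=
  Summit.NavierStokesRegularity.NavierStokesRegularity.Theorems.PowerGaugeEulerLiouville.SwirlfreeLedger.axisLedgerDecay_of_classical

/-- STUB S2 [FILLED BY NAME — p609033 `Theorems/…SwirlfreeLedgerFlow.lean` + p609539 `Theorems/…SwirlfreeLedgerConfinement.lean`,
`SwirlfreeLedger.materialConfinement_of_swirlFreeDrifting` (ns-sfl-p1 g2): localised particle flow of the cut-off field `χ u`
(`ODE.IsUniformlyLipschitzOn` by compactness), confinement `R₀ + K a^{2−2κ₀} ≤ a`, axis invariance, transport of `ω_θ/r`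
(`chenHou_omegaTilde_transport`, `Γ ≡ 0`) along off-axis trajectories, `det Dφ = 1` (Liouville) + change of variables; glue = `exact`]. -/
theorem stub_materialConfinement : Sig.stub_materialConfinement :=
  Summit.NavierStokesRegularity.NavierStokesRegularity.Theorems.PowerGaugeEulerLiouville.SwirlfreeLedger.materialConfinement_of_swirlFreeDrifting

/-- STUB S3 [FILLED BY NAME — p607773 `Theorems/…SwirlfreeLedgerEndgame.lean`, `SwirlfreeLedger.ledgerEndgame_of_classical` (ns-sfl-p1 g2):
average the monotone ledger over `t₁ ∈ (−a², −a²/2)` against the decay, `∫_{B(R₀)} f(t₀)^q = 0`, axis null, continuity ⇒ `curl u(τ) ≡ 0`,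
then the lead's `PastIrrotational.ae_eq_zero_of_gauge_of_pastIrrotational` BY NAME with `T₁ = 0`; glue = `exact`]. -/
theorem stub_ledgerEndgame : Sig.stub_ledgerEndgame :=
  Summit.NavierStokesRegularity.NavierStokesRegularity.Theorems.PowerGaugeEulerLiouville.SwirlfreeLedger.ledgerEndgame_of_classical

/-- STUB S4 [OPEN residue, not claimed]. -/
theorem stub_driftlessRest : Sig.stub_driftlessRest := by
  sorry

/-! ## Composition -/

/-- For every `ρ > 0` the ledger exponent range `(6/(6+ρ), 1)` is non-empty; we pick its midpoint. -/
theorem exists_ledgerExponent {ρ : ℝ} (hρ : 0 < ρ) :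
    ∃ q : ℝ, 6 / (6 + ρ) < q ∧ q < 1 ∧ 0 < q := by
  have h6 : 6 / (6 + ρ) < 1 := by
    rw [div_lt_one (by linarith)]
    linarith
  have h0 : 0 < 6 / (6 + ρ) := by positivity
  exact ⟨(6 / (6 + ρ) + 1) / 2, by linarith, by linarith, by linarith⟩

/-- **Composition (kernel-checked, no sorry of its own): the four stubs give the crux BY NAME.** -/
theorem PowerGaugeEulerLiouville_of :
    Sig.stub_axisLedgerDecay → Sig.stub_materialConfinement → Sig.stub_ledgerEndgame → Sig.stub_driftlessRest →
      Summit.NavierStokesRegularity.NavierStokesRegularity.Theses.EulerZoomLiouville.PowerGaugeEulerLiouville := by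
  intro h1 h2 h3 h4 ρ hρ u p H c hsw hH hc
  by_cases hhalf : 1 / 2 < ρ
  · exact
      Summit.NavierStokesRegularity.NavierStokesRegularity.Theorems.PowerGaugeEulerLiouville.powerGaugeEulerLiouville_largeRho
        ρ hhalf u p H c hsw hH hc
  · have hρ2 : ρ ≤ 1 / 2 := not_lt.mp hhalf
    by_cases hS : IsSwirlFreeDrifting u p
    · obtain ⟨q, hq1, hq2, hq0⟩ := exists_ledgerExponent hρ
      exact h3 ρ hρ hρ2 u p H c ⟨hsw, hH, hc⟩ hS.1
        ⟨q, hq1, hq2, h1 ρ hρ hρ2 u p H c ⟨hsw, hH, hc⟩ hS.1 q hq1 hq2, h2 u p hS q hq0⟩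
    · exact h4 ρ hρ hρ2 u p H c ⟨hsw, hH, hc⟩ hS

end Summit.NavierStokesRegularity.NavierStokesRegularity.Cruxes.PowerGaugeEulerLiouville.SwirlfreeLedger
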